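import Summits.CriticalPhenomena.Ising3DConformalLimit.Theses.LeeYangGap
import Summits.CriticalPhenomena.Ising3DConformalLimit.Theorems.LeeYangGapGaussianLimitKillsBlockCouplingBlockSums
import Summits.CriticalPhenomena.Ising3DConformalLimit.Theorems.LeeYangGapGaussianLimitKillsBlockCouplingDoubling

/-!
# A Gaussian scale-covariant pointwise limit kills the block Binder coupling
(route LeeYangGap, support item stmt-CriticalPhenomena-4950 `GaussianLimitKillsBlockCoupling`: PROOF)

With `M_L = Σ_{x ∈ Λ_L} σ_x`, `Σ_L = ⟨M_L²⟩_{β_c}` on `ℤ³`: if `(ρ, Δ, S)` is a pointwise scaling limit of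
`criticalCorr 3` (`ρ > 0` on `(0,1]`) with non-degenerate two-point function, scale covariant with
dimension `Δ`, and `U₄^S ≡ 0` on non-coincident configurations, then the block Binder coupling
`g_L = (3Σ_L² - ⟨M_L⁴⟩)/Σ_L² → 0` (`gaussianLimitKillsBlockCoupling_proof`, literally the route decl).

Proof (the dimension count of Aizenman, CDM 2020 §10.1, for block sums; the two-sided `L⁵`
hypothesis of the sibling `PerfectScreeningCoulombImpliesNontrivial.stub_gaussianKillsBinder` is
replaced by scale covariance). `3Σ_L² - ⟨M_L⁴⟩ = -Σ_{Λ_L⁴} U₄^{lat}`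
(`three_mul_sq_sub_fourth_eq_neg_sum_ursellFour`). Split `Λ_L⁴` at sup-distance `n = ⌊ηL⌋`
(`sum_abs_ursellFour_le_of_rowSum`, helper file `…BlockSums`): the near part is
`≤ 12|Λ_L| χ(n) Σ_L` with `χ(n) = Σ_{Λ_n}⟨σ₀σ_z⟩` (`|U₄| ≤ 2⟨σσ⟩⟨σσ⟩` for the pairing of the close
pair), and `Σ_L ≥ |Λ_{L/2}| χ(L/2)` (`card_mul_boxSum_le_blockSum`), so near`/Σ_L² ≤ 324 χ(ηL)/χ(L/2)`,
small by the doubling lemma `exists_eta_boxSum_floor_le` (helper file `…Doubling`: scale covariance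
with `Δ ≤ 1` makes `⟨σ₀σ_{2^k e₁}⟩` doubling, hence short distances do not dominate `χ`); on the far
part `ρ(1/L)⁴|U₄^{lat}| ≤ ε'` uniformly for large `L` (`eventually_forall_far_rescaled_ursellFour_le`),
while `Σ_L ≥ |Λ_{L/2}|² ⟨σ₀σ_{2Le₁}⟩ ≳ L⁶ ρ(1/L)⁻²` (`card_sq_mul_axis_le_blockSum` and the limit at
the exact lattice pair `(0, 2Le₁)`, `tendsto_renorm_sq_mul_axis_two`), so far`/Σ_L² ≤ 27⁴ ε'·4/s²`.

## References

* M. Aizenman, CDM 2020 (arXiv:2112.04248), §10.1 [AizenmanCDM2020].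
* M. Aizenman, H. Duminil-Copin, Ann. Math. 194 (2021), Prop. 1.4 (U₄ criterion), eq. (3.12)
  [AizenmanDuminilCopinAnnals2021].
-/

noncomputable section

namespace Summit.CriticalPhenomena.Ising3DConformalLimit.LeeYangGapGaussianLimitKillsBlockCoupling

open Literature.Probability.LatticeModels Filter Set Finset
open scoped Topology BigOperators

/-- The real arithmetic of the near/far assembly: with `N ≤ 27L³` sites, `N₂ ≥ L³` sites in the half
box, row-sum bound `X ≤ ε χ₂/1296`, block sum `Sg ≥ N₂ χ₂` and `Sg ≥ N₂² g` with `ρ₂ g ≥ s/2`, and far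
bound `M = ε s² ρ₂⁻²/(16·27⁴)`, the near/far majorant is `≤ (ε/2) Sg²`. -/
theorem glkb_arith {ε s Lr N N2 Sg χ2 X g ρ2 M T : ℝ} (hε : 0 < ε) (hs : 0 < s) (hLr : 1 ≤ Lr)
    (hN0 : 0 ≤ N) (hN : N ≤ 27 * Lr ^ 3) (hN2 : Lr ^ 3 ≤ N2) (hχ2 : 0 ≤ χ2) (hX0 : 0 ≤ X)
    (hX : X ≤ ε / (4 * 12 * 27) * χ2) (hSg1 : N2 * χ2 ≤ Sg) (hSg2 : N2 ^ 2 * g ≤ Sg)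
    (hρ2 : 0 < ρ2) (hg : s / 2 ≤ ρ2 * g) (hM : M = ε * s ^ 2 / (16 * 27 ^ 4) * (ρ2 ^ 2)⁻¹)
    (hT : T ≤ 12 * (N * X) * Sg + N ^ 4 * M) :
    T ≤ ε / 2 * Sg ^ 2 := by
  have hLr0 : 0 < Lr := by linarith
  have hN20 : 0 ≤ N2 := le_trans (by positivity) hN2
  have hSg0 : 0 ≤ Sg := le_trans (mul_nonneg hN20 hχ2) hSg1
  -- the near term
  have hnear : 12 * (N * X) * Sg ≤ ε / 4 * Sg ^ 2 := by
    have h1 : N * X ≤ 27 * (ε / (4 * 12 * 27)) * Sg := by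
      calc N * X ≤ (27 * Lr ^ 3) * (ε / (4 * 12 * 27) * χ2) := mul_le_mul hN hX hX0 (by positivity)
        _ = 27 * (ε / (4 * 12 * 27)) * (Lr ^ 3 * χ2) := by ring
        _ ≤ 27 * (ε / (4 * 12 * 27)) * (N2 * χ2) := by gcongr
        _ ≤ 27 * (ε / (4 * 12 * 27)) * Sg := by gcongr
    calc 12 * (N * X) * Sg ≤ 12 * (27 * (ε / (4 * 12 * 27)) * Sg) * Sg := by gcongr
      _ = ε / 4 * Sg ^ 2 := by ring
  -- the far term
  have hfar : N ^ 4 * M ≤ ε / 4 * Sg ^ 2 := by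
    have h1 : Lr ^ 6 * g ≤ Sg := by
      have hgpos : 0 < g := by
        by_contra h
        push Not at h
        nlinarith
      calc Lr ^ 6 * g = (Lr ^ 3) ^ 2 * g := by ring
        _ ≤ N2 ^ 2 * g := by gcongr
        _ ≤ Sg := hSg2
    have h2 : Lr ^ 6 * s ≤ 2 * ρ2 * Sg := by
      have h := mul_le_mul_of_nonneg_left hg (by positivity : (0 : ℝ) ≤ Lr ^ 6)
      nlinarith
    have h3 : Lr ^ 12 * s ^ 2 ≤ 4 * ρ2 ^ 2 * Sg ^ 2 := by
      have h0 : 0 ≤ Lr ^ 6 * s := by positivity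
      calc Lr ^ 12 * s ^ 2 = (Lr ^ 6 * s) * (Lr ^ 6 * s) := by ring
        _ ≤ (2 * ρ2 * Sg) * (2 * ρ2 * Sg) := mul_le_mul h2 h2 h0 (by positivity)
        _ = 4 * ρ2 ^ 2 * Sg ^ 2 := by ring
    have hN4 : N ^ 4 ≤ 27 ^ 4 * Lr ^ 12 := by
      calc N ^ 4 ≤ (27 * Lr ^ 3) ^ 4 := pow_le_pow_left₀ hN0 hN 4
        _ = 27 ^ 4 * Lr ^ 12 := by ring
    have hM0 : 0 ≤ M := by rw [hM]; positivity
    have hρ2ne : ρ2 ^ 2 ≠ 0 := by positivity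
    calc N ^ 4 * M ≤ 27 ^ 4 * Lr ^ 12 * M := mul_le_mul_of_nonneg_right hN4 hM0
      _ = ε / 16 * ((Lr ^ 12 * s ^ 2) * (ρ2 ^ 2)⁻¹) := by rw [hM]; ring
      _ ≤ ε / 16 * ((4 * ρ2 ^ 2 * Sg ^ 2) * (ρ2 ^ 2)⁻¹) := by gcongr
      _ = ε / 4 * Sg ^ 2 := by field_simp; ring
  linarith

/-- **A Gaussian scale-covariant pointwise limit kills the block Binder coupling** (route LeeYangGap,
item stmt-CriticalPhenomena-4950): if `(ρ, Δ, S)` is a pointwise scaling limit of `criticalCorr 3`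
with `ρ > 0` on `(0,1]`, non-degenerate two-point function, scale covariant with dimension `Δ`, and
`U₄^S ≡ 0` on non-coincident configurations, then
`g_L = (3⟨M_L²⟩² - ⟨M_L⁴⟩)/⟨M_L²⟩² → 0` for the critical block spin `M_L = Σ_{x ∈ Λ_L} σ_x` on `ℤ³`.
[cite: AizenmanCDM2020, §10.1 eqs. (10.1)–(10.2)] -/
theorem gaussianLimitKillsBlockCoupling_proof :
    Summit.CriticalPhenomena.Ising3DConformalLimit.Theses.LeeYangGap.GaussianLimitKillsBlockCoupling := by
  intro ρ Δ S hρ hlim hnd hsc hU4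
  classical
  -- notation: `Sg L = Σ_L`, the lattice Ursell function `U`, the box two-point sum `χ`
  obtain ⟨Sg, hSg⟩ : ∃ Sg : ℕ → ℝ, ∀ L, Sg L =
      plusExpect 3 (criticalBeta 3) 0 (fun σ => (∑ x ∈ box 3 L, spinAt x σ) ^ 2) := ⟨_, fun _ => rfl⟩
  obtain ⟨U, hU⟩ : ∃ U : Site 3 → Site 3 → Site 3 → Site 3 → ℝ, ∀ a b c e, U a b c e =
      criticalCorr 3 4 ![a, b, c, e] -
        (criticalCorr 3 2 ![a, b] * criticalCorr 3 2 ![c, e] +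
          criticalCorr 3 2 ![a, c] * criticalCorr 3 2 ![b, e] +
          criticalCorr 3 2 ![a, e] * criticalCorr 3 2 ![b, c]) := ⟨_, fun _ _ _ _ => rfl⟩
  obtain ⟨χ, hχ⟩ : ∃ χ : ℕ → ℝ, ∀ m, χ m = ∑ z ∈ box 3 m, criticalTwoPoint 3 z := ⟨_, fun _ => rfl⟩
  -- the numerator is `-Σ U` and `|numerator| ≤ Σ |U|`
  have hnum : ∀ L : ℕ, |3 * Sg L ^ 2 -
      plusExpect 3 (criticalBeta 3) 0 (fun σ => (∑ x ∈ box 3 L, spinAt x σ) ^ 4)| ≤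
      ∑ a ∈ box 3 L, ∑ b ∈ box 3 L, ∑ c' ∈ box 3 L, ∑ e ∈ box 3 L, |U a b c' e| := by
    intro L
    rw [hSg, three_mul_sq_sub_fourth_eq_neg_sum_ursellFour 3 L, abs_neg]
    simp only [← hU]
    refine (Finset.abs_sum_le_sum_abs _ _).trans (Finset.sum_le_sum fun a _ => ?_)
    refine (Finset.abs_sum_le_sum_abs _ _).trans (Finset.sum_le_sum fun b _ => ?_)
    refine (Finset.abs_sum_le_sum_abs _ _).trans (Finset.sum_le_sum fun c _ => ?_)
    exact Finset.abs_sum_le_sum_abs _ _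
  -- six separations `‖yᵢ - yⱼ‖_∞ > ηL` (`i < j`) give all twelve ordered ones
  have hsix : ∀ {t : ℝ} {y : Fin 4 → Site 3},
      t < Site.supNorm (y 0 - y 1) → t < Site.supNorm (y 0 - y 2) →
      t < Site.supNorm (y 0 - y 3) → t < Site.supNorm (y 1 - y 2) →
      t < Site.supNorm (y 1 - y 3) → t < Site.supNorm (y 2 - y 3) →
      ∀ i j : Fin 4, i ≠ j → t < Site.supNorm (y i - y j) := by
    intro t y h01 h02 h03 h12 h13 h23 i j hij
    fin_cases i <;> fin_cases j <;> first
      | exact absurd rfl hij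
      | assumption
      | (rw [Site.supNorm_sub_comm]; assumption)
  -- `Σ_L` as a pair sum
  have hSgsum : ∀ L, Sg L = ∑ a ∈ box 3 L, ∑ b ∈ box 3 L, criticalCorr 3 2 ![a, b] := fun L => by
    rw [hSg, plusExpect_blockSpin_sq_eq_sum 3 L]
  -- the reference value `s = S₂(0, 2e) > 0` and the limit at the exact lattice pair `(0, 2Le₁)`
  have hspos : 0 < S 2 ![0, EuclideanSpace.single (0 : Fin 3) ((2 : ℕ) : ℝ)] :=
    hnd _ (zero_unitVec_mem_nonCoincident (by norm_num))
  have hpt := tendsto_renorm_sq_mul_axis_two hlim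
  obtain ⟨s, hs⟩ : ∃ s : ℝ, S 2 ![0, EuclideanSpace.single (0 : Fin 3) ((2 : ℕ) : ℝ)] = s := ⟨_, rfl⟩
  rw [hs] at hspos hpt
  have hptL : ∀ᶠ L : ℕ in atTop,
      s / 2 < ρ (1 / (L : ℝ)) ^ 2 * criticalTwoPoint 3 (Pi.single 0 ((2 * L : ℕ) : ℤ)) :=
    hpt.eventually_const_lt (half_lt_self hspos)
  rw [Metric.tendsto_nhds]
  intro ε hε
  -- the doubling lemma fixes `η`
  obtain ⟨η, hηpos, -, hdblL⟩ := exists_eta_boxSum_floor_le hρ hlim hnd hsc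
    (show (0 : ℝ) < ε / (4 * 12 * 27) by positivity)
  -- far smallness
  obtain ⟨ε', hε'def⟩ : ∃ ε' : ℝ, ε' = ε * s ^ 2 / (16 * 27 ^ 4) := ⟨_, rfl⟩
  have hε'pos : 0 < ε' := by rw [hε'def]; positivity
  have hfarL := eventually_forall_far_rescaled_ursellFour_le (d := 3) le_rfl hlim hU4 hηpos hε'pos
  filter_upwards [hfarL, hptL, hdblL, eventually_ge_atTop 1] with L hfar hptv hdbl hL1
  rw [Real.dist_eq, sub_zero]
  -- real bookkeeping at this `L`
  have hLr : (1 : ℝ) ≤ L := by exact_mod_cast hL1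
  have hLr0 : (0 : ℝ) < L := by positivity
  have hρpos : 0 < ρ (1 / (L : ℝ)) :=
    hρ _ ⟨by positivity, by rw [div_le_one hLr0]; exact hLr⟩
  obtain ⟨ρ2, hρ2⟩ : ∃ ρ2 : ℝ, ρ (1 / (L : ℝ)) ^ 2 = ρ2 := ⟨_, rfl⟩
  have hρ2pos : 0 < ρ2 := by rw [← hρ2]; exact pow_pos hρpos 2
  rw [hρ2] at hptv
  -- the far bound `M`
  obtain ⟨M, hMdef⟩ : ∃ M : ℝ, M = ε' * (ρ2 ^ 2)⁻¹ := ⟨_, rfl⟩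
  have hM0 : 0 ≤ M := by rw [hMdef]; positivity
  set n : ℕ := ⌊η * L⌋₊ with hn
  have hconv : ∀ u v : Site 3, n < Site.supNorm (v - u) →
      η * L < Site.supNorm (u - v) ∧ η * L < Site.supNorm (v - u) := by
    intro u v h
    have h' : (n : ℝ) + 1 ≤ Site.supNorm (v - u) := by exact_mod_cast h
    have hfl : η * L < (n : ℝ) + 1 := Nat.lt_floor_add_one _
    rw [Site.supNorm_sub_comm u v]
    exact ⟨by linarith, by linarith⟩
  have hfarM : ∀ a ∈ box 3 L, ∀ b ∈ box 3 L, ∀ c' ∈ box 3 L, ∀ e ∈ box 3 L,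
      n < Site.supNorm (b - a) → n < Site.supNorm (e - c') → n < Site.supNorm (c' - a) →
      n < Site.supNorm (e - b) → n < Site.supNorm (e - a) → n < Site.supNorm (c' - b) →
      |criticalCorr 3 4 ![a, b, c', e] -
        (criticalCorr 3 2 ![a, b] * criticalCorr 3 2 ![c', e] +
          criticalCorr 3 2 ![a, c'] * criticalCorr 3 2 ![b, e] +
          criticalCorr 3 2 ![a, e] * criticalCorr 3 2 ![b, c'])| ≤ M := by
    intro a ha b hb c' hc e he h1 h2 h3 h4 h5 h6
    have hy := hfar ![a, b, c', e] (fun i => by fin_cases i <;> assumption)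
      (hsix (by simpa using (hconv _ _ h1).1) (by simpa using (hconv _ _ h3).1)
        (by simpa using (hconv _ _ h5).1) (by simpa using (hconv _ _ h6).1)
        (by simpa using (hconv _ _ h4).1) (by simpa using (hconv _ _ h2).1))
    simp only [Matrix.cons_val_zero, Matrix.cons_val_one, Matrix.cons_val] at hy
    -- `hy : ρ(1/L)⁴ |U| ≤ ε'`
    have hρ4eq : ρ (1 / (L : ℝ)) ^ 4 = ρ2 ^ 2 := by rw [← hρ2]; ring
    rw [hρ4eq] at hy
    have hρ4 : 0 < ρ2 ^ 2 := pow_pos hρ2pos 2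
    rw [hMdef]
    calc _ = (ρ2 ^ 2)⁻¹ * (ρ2 ^ 2 * |criticalCorr 3 4 ![a, b, c', e] -
          (criticalCorr 3 2 ![a, b] * criticalCorr 3 2 ![c', e] +
            criticalCorr 3 2 ![a, c'] * criticalCorr 3 2 ![b, e] +
            criticalCorr 3 2 ![a, e] * criticalCorr 3 2 ![b, c'])|) := by
          rw [← mul_assoc, inv_mul_cancel₀ hρ4.ne', one_mul]
      _ ≤ (ρ2 ^ 2)⁻¹ * ε' := mul_le_mul_of_nonneg_left hy (inv_nonneg.2 hρ4.le)
      _ = ε' * (ρ2 ^ 2)⁻¹ := mul_comm _ _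
  -- the near/far split at this `L`, with the row-sum bound `χ n`
  have hT := sum_abs_ursellFour_le_of_rowSum (d := 3) le_rfl L n (X := χ n) hM0
    (fun u => by rw [hχ]; exact rowSum_le_boxSum L n u) hfarM
  simp only [← hU] at hT
  rw [← hSgsum] at hT
  -- inputs of the arithmetic
  have hN := card_box_le L hL1
  have hN2 := pow_three_le_card_box_half L
  have hSg1 : (#(box 3 (L / 2)) : ℝ) * χ (L / 2) ≤ Sg L := by
    rw [hχ, hSgsum]; exact card_mul_boxSum_le_blockSum L
  have hSg2 : (#(box 3 (L / 2)) : ℝ) ^ 2 * criticalTwoPoint 3 (Pi.single 0 ((2 * L : ℕ) : ℤ)) ≤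
      Sg L := by
    rw [hSgsum]; exact card_sq_mul_axis_le_blockSum L
  have hX : χ n ≤ ε / (4 * 12 * 27) * χ (L / 2) := by rw [hχ, hχ]; exact hdbl
  have hχ2 : 0 ≤ χ (L / 2) := by rw [hχ]; exact boxSum_nonneg _
  have hX0 : 0 ≤ χ n := by rw [hχ]; exact boxSum_nonneg _
  have hTle := glkb_arith hε hspos hLr (Nat.cast_nonneg _) hN hN2 hχ2 hX0 hX hSg1 hSg2 hρ2pos
    hptv.le (by rw [hMdef, hε'def]) hT
  -- positivity of `Σ_L`
  have hSpos : 0 < Sg L := by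
    have h1 : (1 : ℝ) ≤ χ (L / 2) := by rw [hχ]; exact one_le_boxSum _
    have h3 : (1 : ℝ) ≤ (L : ℝ) ^ 3 := one_le_pow₀ hLr
    calc (0 : ℝ) < 1 := one_pos
      _ ≤ (#(box 3 (L / 2)) : ℝ) * χ (L / 2) := by nlinarith
      _ ≤ Sg L := hSg1
  -- conclusion
  rw [← hSg, abs_div, abs_of_pos (pow_pos hSpos 2), div_lt_iff₀ (pow_pos hSpos 2)]
  calc |3 * Sg L ^ 2 - plusExpect 3 (criticalBeta 3) 0 (fun σ => (∑ x ∈ box 3 L, spinAt x σ) ^ 4)|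
      ≤ ∑ a ∈ box 3 L, ∑ b ∈ box 3 L, ∑ c' ∈ box 3 L, ∑ e ∈ box 3 L, |U a b c' e| := hnum L
    _ ≤ ε / 2 * Sg L ^ 2 := hTle
    _ < ε * Sg L ^ 2 := by nlinarith [pow_pos hSpos 2]

end Summit.CriticalPhenomena.Ising3DConformalLimit.LeeYangGapGaussianLimitKillsBlockCoupling

end
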